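import Literature.NumberTheory.GaloisRepresentations.WildInertia
import Literature.NumberTheory.GaloisRepresentations.InertiaPadicCharacterProofs
import Literature.NumberTheory.GaloisRepresentations.LAdicCharacterUnramifiedAEProofs
import Summits.Langlands.Langlands.Theorems.PhantomRMYoshidaResiduallyYoshidaLiftingGreenbergSelmerDefs
import Mathlib.Topology.Algebra.ClopenNhdofOne
import HarnessLib

/-!
# THE TAME RELATION OF A RAMIFIED CLASS (stub `stub_ramifiedClassTameRelation`, LR) — line
# `sector-klingen-split`, crux `ResiduallyYoshidaLifting` (stmt-Langlands-13639)

Stub-worker of lead prover-line-stmt-Langlands-13639-c5-0 (continuation c5, skeleton rev 16, sub-goal LR, 2026-08-17).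

**Theorem (`stub_ramifiedClassTameRelation`, registered signature verbatim).**  Let `v ∤ p` be a finite place of
`ℚ`, let `σ̄, σ̄' : Γ_ℚ → GL₂(k)` (`char k = p`) be unramified at `v` (trivial on the inertia group `I_v` of
`Γ_{ℚ_v}`, through the fixed restriction `res = absGaloisRestrict ℚ ℚ_v`), and let `B : Γ_ℚ → M₂(k)` be a locally
constant `Hom(σ̄', σ̄)`-cocycle, `B(g g') = σ̄(g) B(g') + B(g) σ̄'(g')`.  Then for every Frobenius element `φ`
of `Γ_{ℚ_v}` (`IsFrobPow φ 1`) and every `τ ∈ I_v`,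
`σ̄(res φ) B(res τ) = q_v · B(res τ) σ̄'(res φ)`, `q_v = #𝓀[ℚ_v]`.

**Proof.**  Pull everything back to `Γ_{ℚ_v}`: `B_v = B ∘ res`, `S = σ̄ ∘ res`, `S' = σ̄' ∘ res` still satisfy
the cocycle identity (`res` is a homomorphism), `B_v` is locally constant (`res` is continuous) and
`S = S' = 1` on `I_v`.
1. On `I_v` the cocycle is an additive homomorphism: `B_v(τ₁ τ₂) = B_v(τ₁) + B_v(τ₂)`, so `B_v(1) = 0` and
   `B_v(τⁿ) = n • B_v(τ)`.
2. Wild inertia is killed: the fibre `{B_v = 0}` is clopen and contains `1`, hence contains an open normal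
   subgroup `N` of the compact group `Γ_{ℚ_v}` (Mathlib `exist_openNormalSubgroup_sub_clopen_nhds_of_one`); for
   `w ∈ P_v` some `w^{ℓ^a}` lies in `N` (`absWildInertia_isProP_holds`: `P_v` is pro-`ℓ`, `ℓ = char 𝓀[ℚ_v]`), so
   `ℓ^a • B_v(w) = 0`, and `ℓ ≠ p = char k` (`v ∤ p`, `not_ringChar_residueField_adicCompletion_dvd_of_not_mem`)
   gives `B_v(w) = 0`.
3. Tame relation: `x = φ τ φ⁻¹ τ^{-q} ∈ P_v` (`conj_mul_pow_inv_mem_absWildInertia`, Serre 1972 §1.8 Prop. 6), so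
   `B_v(φ τ φ⁻¹) = B_v(x) + B_v(τ^q) = q • B_v(τ)`.
4. Cocycle algebra: `B_v(φ τ φ⁻¹) = S(φ) B_v(τ) S'(φ)⁻¹` (expand `B_v(φ τ · φ⁻¹)` and `0 = B_v(φ φ⁻¹)`), whence
   `S(φ) B_v(τ) = B_v(φ τ φ⁻¹) S'(φ) = q • B_v(τ) S'(φ)`.
No new definitions, no named fact taken as a hypothesis (`absWildInertia_isProP_holds`, `absInertia_normal_holds`
are the discharged forms).
-/

noncomputable section

-- `Summit.Langlands.Langlands.…` (summit = sub-problem name, D-0017 layout) trips `dupNamespace` on every decl.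
set_option linter.dupNamespace false
set_option autoImplicit false

open IsDedekindDomain Filter
open scoped Matrix ValuativeRel
open Literature.NumberTheory.GaloisRepresentations Literature.NumberTheory.Automorphic

namespace Summit.Langlands.Langlands.Cruxes.ResiduallyYoshidaLifting.SectorKlingenSplit.Fibre

/-! ## Pure algebra: cocycles that are additive on a subgroup -/

/-- A function on a group which is additive on a subgroup `H` vanishes at `1`. [folklore] -/
private theorem apply_one_eq_zero_of_add_on {G : Type*} [Group G] {R : Type*} [AddCommGroup R]
    {H : Subgroup G} (B : G → R) (hadd : ∀ a ∈ H, ∀ b ∈ H, B (a * b) = B a + B b) : B 1 = 0 := by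
  have h : B 1 + B 1 = B 1 + 0 := by rw [add_zero, ← hadd 1 H.one_mem 1 H.one_mem, mul_one]
  exact add_left_cancel h

/-- A function on a group which is additive on a subgroup `H` satisfies `B (aⁿ) = n • B a` on `H`. [folklore] -/
private theorem apply_pow_of_add_on {G : Type*} [Group G] {R : Type*} [AddCommGroup R]
    {H : Subgroup G} (B : G → R) (hadd : ∀ a ∈ H, ∀ b ∈ H, B (a * b) = B a + B b)
    {a : G} (ha : a ∈ H) : ∀ n : ℕ, B (a ^ n) = n • B a
  | 0 => by rw [pow_zero, zero_smul, apply_one_eq_zero_of_add_on B hadd]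
  | n + 1 => by
    rw [pow_succ, hadd _ (H.pow_mem ha n) _ ha, apply_pow_of_add_on B hadd ha n, succ_nsmul]

/-- A `Hom(S', S)`-cocycle `B(g g') = S(g) B(g') + B(g) S'(g')` is additive on any subgroup on which
`S = S' = 1`. [folklore] -/
private theorem cocycle_add_on {G : Type*} [Group G] {R : Type*} [Ring R] (S S' : G →* R) (B : G → R)
    (hB : ∀ g g', B (g * g') = S g * B g' + B g * S' g') {H : Subgroup G}
    (hS : ∀ a ∈ H, S a = 1) (hS' : ∀ a ∈ H, S' a = 1) :
    ∀ a ∈ H, ∀ b ∈ H, B (a * b) = B a + B b := fun a ha b hb => by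
  rw [hB, hS a ha, hS' b hb, one_mul, mul_one, add_comm]

/-- THE CONJUGATION IDENTITY of a `Hom(S', S)`-cocycle: if `S(τ) = S'(τ) = 1` then
`S(φ) B(τ) = B(φ τ φ⁻¹) S'(φ)` (expand `B(φ τ · φ⁻¹)` twice and subtract `0 = B(φ φ⁻¹)`). [folklore] -/
private theorem cocycle_conj_identity {G : Type*} [Group G] {R : Type*} [Ring R] (S S' : G →* R)
    (B : G → R) (hB : ∀ g g', B (g * g') = S g * B g' + B g * S' g') {φ τ : G}
    (hSτ : S τ = 1) (hS'τ : S' τ = 1) : S φ * B τ = B (φ * τ * φ⁻¹) * S' φ := by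
  -- `B 1 = 0`
  have h1 : B 1 = 0 := by
    have h : B 1 + B 1 = B 1 + 0 := by
      rw [add_zero]
      conv_rhs => rw [← mul_one (1 : G), hB, map_one, map_one, one_mul, mul_one]
    exact add_left_cancel h
  -- `0 = B (φ φ⁻¹) = S φ B φ⁻¹ + B φ S' φ⁻¹`
  have h0 : S φ * B φ⁻¹ + B φ * S' φ⁻¹ = 0 := by rw [← hB, mul_inv_cancel, h1]
  -- `B (φ τ φ⁻¹) = S φ B τ S' φ⁻¹`
  have e : B (φ * τ * φ⁻¹) = S φ * B τ * S' φ⁻¹ := by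
    rw [hB, hB φ τ, map_mul, hSτ, hS'τ, mul_one, mul_one, add_mul]
    calc S φ * B φ⁻¹ + (S φ * B τ * S' φ⁻¹ + B φ * S' φ⁻¹)
        = S φ * B τ * S' φ⁻¹ + (S φ * B φ⁻¹ + B φ * S' φ⁻¹) := by abel
      _ = S φ * B τ * S' φ⁻¹ := by rw [h0, add_zero]
  rw [e, mul_assoc (S φ * B τ), ← map_mul, inv_mul_cancel, map_one, mul_one]

/-! ## Wild inertia is killed by a locally constant cocycle with `ℓ`-torsion-free values -/

/-- **A locally constant function on `Γ_F`, additive on the inertia group, kills the wild inertia group**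
when its values have no `ℓ`-torsion (`ℓ = char 𝓀[F]`): the fibre `{B = 0}` is a clopen neighbourhood of `1`
in the compact group `Γ_F`, so it contains an open normal subgroup `N`; `P_F` is pro-`ℓ`
(`absWildInertia_isProP_holds`), so `w^{ℓ^a} ∈ N` for some `a`, i.e. `ℓ^a • B(w) = B(w^{ℓ^a}) = 0`.
Ref: Serre, *Local Fields*, Ch. IV §2, Cor. 3 of Prop. 7. [folklore] -/
private theorem apply_eq_zero_of_mem_absWildInertia_of_add_on {F : Type*} [Field F] [ValuativeRel F]
    [TopologicalSpace F] [IsNonarchimedeanLocalField F] {R : Type*} [AddCommGroup R]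
    (B : Field.absoluteGaloisGroup F → R) (hlc : IsLocallyConstant B)
    (hadd : ∀ a ∈ absInertia F, ∀ b ∈ absInertia F, B (a * b) = B a + B b)
    (htors : ∀ (n : ℕ) (x : R), ringChar 𝓀[F] ^ n • x = 0 → x = 0)
    {ϖ : 𝒪[F]} (hϖ : Irreducible ϖ) {w : Field.absoluteGaloisGroup F} (hw : w ∈ absWildInertia F ϖ) :
    B w = 0 := by
  haveI : CompactSpace (Field.absoluteGaloisGroup F) := absoluteGaloisGroup_compactSpace F
  have h1 : (1 : Field.absoluteGaloisGroup F) ∈ {x | B x = 0} := apply_one_eq_zero_of_add_on B hadd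
  obtain ⟨N, hN⟩ :=
    IsTopologicalGroup.exist_openNormalSubgroup_sub_clopen_nhds_of_one (hlc.isClopen_fiber 0) h1
  obtain ⟨a, ha⟩ :=
    absWildInertia_isProP_holds F hϖ hw (N : Subgroup (Field.absoluteGaloisGroup F)) N.isOpen
  have hBa : B (w ^ ringChar 𝓀[F] ^ a) = 0 := hN ha
  rw [apply_pow_of_add_on B hadd (absWildInertia_le_absInertia F ϖ hw)] at hBa
  exact htors _ _ hBa

/-! ## The registered statement -/

/-- **Registered statement `stub_ramifiedClassTameRelation`** (LR; THE TAME RELATION OF A RAMIFIED CLASS).  Let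
`v ∤ p` and let `σ̄, σ̄'` be unramified at `v` (trivial on the inertia group of `Γ_{ℚ_v}`).  A locally constant
`Hom(σ̄', σ̄)`-cocycle `B` restricted to `I_v` is an additive homomorphism; it KILLS WILD INERTIA (`P_v` is
pro-`ℓ`, `ℓ ≠ p`, and `B(I_v)` has exponent `p`: `absWildInertia_isProP_holds`), and for a Frobenius element `φ`
(`IsFrobPow φ 1`) the cocycle identity `B(φ τ φ⁻¹) = σ̄(φ) B(τ) σ̄'(φ)⁻¹` combined with the tame relation
`φ τ φ⁻¹ ≡ τ^{q_v} (mod P_v)` (`conj_mul_pow_inv_mem_absWildInertia`) gives `σ̄(φ) B(τ) = q_v · B(τ) σ̄'(φ)` for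
every `τ ∈ I_v`.  Consequence: a Greenberg–Selmer class ramifies at `v` only where `q_v` is an eigenvalue of
`X ↦ σ̄(φ) X σ̄'(φ)⁻¹` — the ×-type level-raising position of line C (LR2).
[cite: SerreInventiones1972, §1.8 Prop. 6 (Frobenius acts on tame inertia by q)] -/
theorem stub_ramifiedClassTameRelation :
    ∀ (p : ℕ) [Fact p.Prime] (k : Type) [Field k] [CharP k p] [TopologicalSpace k] [DiscreteTopology k]
      (σ σ' : FramedGaloisRep ℚ k 2) (B : Field.absoluteGaloisGroup ℚ → Matrix (Fin 2) (Fin 2) k)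
      (v : HeightOneSpectrum (NumberField.RingOfIntegers ℚ)),
      ((p : ℕ) : NumberField.RingOfIntegers ℚ) ∉ v.asIdeal →
      (∀ g g', B (g * g') = (σ g).val * B g' + B g * (σ' g').val) → IsLocallyConstant B →
      (∀ τ ∈ absInertia (v.adicCompletion ℚ),
        σ (absGaloisRestrict ℚ (v.adicCompletion ℚ) τ) = 1 ∧ σ' (absGaloisRestrict ℚ (v.adicCompletion ℚ) τ) = 1) →
      ∀ φ : Field.absoluteGaloisGroup (v.adicCompletion ℚ), IsFrobPow φ 1 →
      ∀ τ ∈ absInertia (v.adicCompletion ℚ),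
        (σ (absGaloisRestrict ℚ (v.adicCompletion ℚ) φ)).val * B (absGaloisRestrict ℚ (v.adicCompletion ℚ) τ) =
          (IsNonarchimedeanLocalField.residueFieldCard (v.adicCompletion ℚ) : k) •
            (B (absGaloisRestrict ℚ (v.adicCompletion ℚ) τ) * (σ' (absGaloisRestrict ℚ (v.adicCompletion ℚ) φ)).val) := by
  intro p _ k _ _ _ _ σ σ' B v hpv hcoc hlc hunr φ hφ τ hτ
  set res := absGaloisRestrict ℚ (v.adicCompletion ℚ) with hres
  -- the pulled-back data on `Γ_{ℚ_v}`: `S = σ̄ ∘ res`, `S' = σ̄' ∘ res` (as monoid homs into `M₂(k)`), `Bv = B ∘ res`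
  obtain ⟨S, hS⟩ : ∃ S : Field.absoluteGaloisGroup (v.adicCompletion ℚ) →* Matrix (Fin 2) (Fin 2) k,
      ∀ g, S g = (σ (res g)).val :=
    ⟨(Units.coeHom (Matrix (Fin 2) (Fin 2) k)).comp (σ.toMonoidHom.comp res.toMonoidHom), fun _ => rfl⟩
  obtain ⟨S', hS'⟩ : ∃ S' : Field.absoluteGaloisGroup (v.adicCompletion ℚ) →* Matrix (Fin 2) (Fin 2) k,
      ∀ g, S' g = (σ' (res g)).val :=
    ⟨(Units.coeHom (Matrix (Fin 2) (Fin 2) k)).comp (σ'.toMonoidHom.comp res.toMonoidHom), fun _ => rfl⟩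
  obtain ⟨Bv, hBv⟩ : ∃ Bv : Field.absoluteGaloisGroup (v.adicCompletion ℚ) → Matrix (Fin 2) (Fin 2) k,
      ∀ g, Bv g = B (res g) := ⟨fun g => B (res g), fun _ => rfl⟩
  have hcocv : ∀ g g', Bv (g * g') = S g * Bv g' + Bv g * S' g' := fun g g' => by
    rw [hBv, hBv, hBv, hS, hS', map_mul, hcoc]
  have hSI : ∀ a ∈ absInertia (v.adicCompletion ℚ), S a = 1 := fun a ha => by
    rw [hS, (hunr a ha).1, Units.val_one]
  have hS'I : ∀ a ∈ absInertia (v.adicCompletion ℚ), S' a = 1 := fun a ha => by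
    rw [hS', (hunr a ha).2, Units.val_one]
  -- (1) additivity on inertia
  have hadd := cocycle_add_on S S' Bv hcocv hSI hS'I
  have hlcv : IsLocallyConstant Bv := by
    rw [show Bv = B ∘ res from funext hBv]
    exact hlc.comp_continuous res.continuous
  -- the residue characteristic `ℓ` of `ℚ_v` is prime to `p = char k`: `M₂(k)` has no `ℓ`-torsion
  have hℓ : (ringChar 𝓀[v.adicCompletion ℚ]).Prime := ringChar_residueField_prime
  have hℓp : ¬ ringChar 𝓀[v.adicCompletion ℚ] ∣ p :=
    not_ringChar_residueField_adicCompletion_dvd_of_not_mem hpv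
  have hne : ((ringChar 𝓀[v.adicCompletion ℚ] : ℕ) : k) ≠ 0 := fun h0 =>
    hℓp (dvd_of_eq ((Nat.Prime.dvd_iff_eq hℓ (Fact.out : p.Prime).one_lt.ne').mp
      ((CharP.cast_eq_zero_iff k p _).mp h0)))
  have htors : ∀ (n : ℕ) (X : Matrix (Fin 2) (Fin 2) k), ringChar 𝓀[v.adicCompletion ℚ] ^ n • X = 0 → X = 0 :=
    fun n X h => by
    rw [← Nat.cast_smul_eq_nsmul k, smul_eq_zero] at h
    exact h.resolve_left (by rw [Nat.cast_pow]; exact pow_ne_zero _ hne)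
  -- (2) wild inertia is killed
  obtain ⟨ϖ, hϖ⟩ := IsDiscreteValuationRing.exists_irreducible 𝒪[v.adicCompletion ℚ]
  have hwild : ∀ w ∈ absWildInertia (v.adicCompletion ℚ) ϖ, Bv w = 0 := fun w hw =>
    apply_eq_zero_of_mem_absWildInertia_of_add_on Bv hlcv hadd htors hϖ hw
  -- (3) the tame relation `φ τ φ⁻¹ = x τ^q`, `x ∈ P_v`
  have hφ1 : IsFrobPow φ ((1 : ℕ) : ℤ) := hφ
  have hx := conj_mul_pow_inv_mem_absWildInertia hϖ.ne_zero hφ1 hτ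
  rw [pow_one] at hx
  have hxI : φ * τ * φ⁻¹ * (τ ^ IsNonarchimedeanLocalField.residueFieldCard (v.adicCompletion ℚ))⁻¹ ∈
      absInertia (v.adicCompletion ℚ) := absWildInertia_le_absInertia _ ϖ hx
  have E1 : Bv (φ * τ * φ⁻¹) = IsNonarchimedeanLocalField.residueFieldCard (v.adicCompletion ℚ) • Bv τ := by
    rw [← inv_mul_cancel_right (φ * τ * φ⁻¹) (τ ^ IsNonarchimedeanLocalField.residueFieldCard (v.adicCompletion ℚ)),
      hadd _ hxI _ (pow_mem hτ _), hwild _ hx, zero_add, apply_pow_of_add_on Bv hadd hτ]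
  -- (4) the conjugation identity and assembly
  have E2 : S φ * Bv τ = Bv (φ * τ * φ⁻¹) * S' φ := cocycle_conj_identity S S' Bv hcocv (hSI τ hτ) (hS'I τ hτ)
  calc (σ (res φ)).val * B (res τ) = S φ * Bv τ := by rw [hS, hBv]
    _ = (IsNonarchimedeanLocalField.residueFieldCard (v.adicCompletion ℚ) • Bv τ) * S' φ := by rw [E2, E1]
    _ = IsNonarchimedeanLocalField.residueFieldCard (v.adicCompletion ℚ) • (Bv τ * S' φ) := smul_mul_assoc _ _ _
    _ = (IsNonarchimedeanLocalField.residueFieldCard (v.adicCompletion ℚ) : k) • (Bv τ * S' φ) :=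
      (Nat.cast_smul_eq_nsmul k _ _).symm
    _ = (IsNonarchimedeanLocalField.residueFieldCard (v.adicCompletion ℚ) : k) • (B (res τ) * (σ' (res φ)).val) := by
      rw [hS', hBv]

end Summit.Langlands.Langlands.Cruxes.ResiduallyYoshidaLifting.SectorKlingenSplit.Fibre

end
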